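import Literature.Computability.Complexity.PrivateCoinGames
import HarnessLib

/-!
# Private-coin games: tools for bounding the value (verdict monotonicity, union bound,
# prover-independent events, conditioning on good coins)

Trunk T-CPLX-CORE, continuation of `PrivateCoinGames.lean` (`PCGame`, `opt`, "no prover beats
`opt`"). The analyses of concrete protocols bound `opt k []` by unfolding the recursion over their
few rounds (`opt_succ_nil`, `opt_succ_of_even`, `opt_succ_of_not_even`, `opt_zero`) and by the
three standard moves made available here once and for all:

* `withAccept`, `opt_mono` — weakening the verdict can only increase the value;
* `opt_union_le` — the value of "`A` or `B`" is at most the sum of the values (union bound against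
  adaptive provers);
* `opt_indep_le`, `opt_indep_nil_le` — a verdict that is an event of the coins alone is worth at
  most the number of such coins, whatever the prover does;
* `opt_le_opt_good_add_card` — **conditioning on good coins**: `opt ≤ opt(accept ∧ good) + #bad`,
  the formal counterpart of "with probability `≥ 1 - δ` over the verifier's choices the hash
  functions / samples are good; conditioned on that, no prover …" in every protocol analysis
  (Goldwasser–Sipser, Aiello–Håstad, Akavia–Goldreich–Goldwasser–Moshkovitz App. B–D).

Written for the bottom-up discharge plan of `Literature.Barriers.PneNP.AkaviaEtAl2006_complMemIPk`;
Mathlib + `PrivateCoinGames.lean` only, all proved, [folklore].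

## References

* [AroraBarakCC2009] S. Arora, B. Barak, *Computational Complexity: A Modern Approach*, CUP 2009,
  §8.1 (the model); the moves are the routine steps of §8.2's protocol analyses.
-/

namespace Literature.Computability.Complexity

open Finset

namespace PCGame

variable {R M : Type*}

/-! ### Unfolding the recursion -/

section Unfold

variable [Fintype R] [Fintype M] (G : PCGame R M)

open scoped Classical in
/-- Leaves count the consistent accepting coins. [folklore] -/
theorem opt_zero (h : List M) :
    G.opt 0 h = (univ.filter fun r => G.Consistent r h ∧ G.accept r h).card := rfl

open scoped Classical in
/-- On the verifier's turn the value is the sum over its messages. [folklore] -/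
theorem opt_succ_of_even {h : List M} (he : Even h.length) (n : ℕ) :
    G.opt (n + 1) h = ∑ a : M, G.opt n (h ++ [a]) := by
  simp [opt, he]

open scoped Classical in
/-- On the prover's turn the value is the best reply's value. [folklore] -/
theorem opt_succ_of_not_even {h : List M} (he : ¬ Even h.length) (n : ℕ) :
    G.opt (n + 1) h = univ.sup fun b : M => G.opt n (h ++ [b]) := by
  simp [opt, he]

open scoped Classical in
/-- The value of the whole `(n+1)`-message game splits over the verifier's first message.
[folklore] -/
theorem opt_succ_nil (n : ℕ) : G.opt (n + 1) [] = ∑ a : M, G.opt n [a] := by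
  simp [opt]

end Unfold

/-! ### Changing the verdict: monotonicity, union bound, prover-independent events -/

/-- The same interaction with another verdict. [folklore] -/
def withAccept (G : PCGame R M) (A : R → List M → Prop) : PCGame R M where
  next := G.next
  accept := A

/-- Replacing the verdict by itself changes nothing. [folklore] -/
@[simp] theorem withAccept_accept (G : PCGame R M) : G.withAccept G.accept = G := by
  cases G
  rfl

/-- Changing the verdict does not change play. [folklore] -/
@[simp] theorem play_withAccept (G : PCGame R M) (A : R → List M → Prop) (r : R) (σ : List M → M)
    (n : ℕ) (h : List M) : (G.withAccept A).play r σ n h = G.play r σ n h := by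
  induction n generalizing h with
  | zero => rfl
  | succ n ih => simp only [play_succ, ih]; rfl

/-- Changing the verdict does not change consistency. [folklore] -/
theorem consistent_withAccept (G : PCGame R M) (A : R → List M → Prop) (r : R)
    (h : List M) : (G.withAccept A).Consistent r h ↔ G.Consistent r h := Iff.rfl

variable [Fintype R] [Fintype M]

open scoped Classical in
/-- **Monotonicity in the verdict**: a more generous verdict has at least the value. [folklore] -/
theorem opt_mono (G : PCGame R M) {A B : R → List M → Prop} (hAB : ∀ r h, A r h → B r h)
    (n : ℕ) (h : List M) : (G.withAccept A).opt n h ≤ (G.withAccept B).opt n h := by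
  induction n generalizing h with
  | zero =>
    simp only [opt]
    exact card_le_card fun r hr => by
      simp only [mem_filter, mem_univ, true_and] at hr ⊢
      exact ⟨hr.1, hAB r h hr.2⟩
  | succ n ih =>
    by_cases he : Even h.length
    · rw [opt_succ_of_even _ he, opt_succ_of_even _ he]
      exact sum_le_sum fun a _ => ih (h ++ [a])
    · rw [opt_succ_of_not_even _ he, opt_succ_of_not_even _ he]
      exact Finset.sup_mono_fun fun b _ => ih (h ++ [b])

open scoped Classical in
/-- **Union bound in the verdict**: the value of "`A` or `B`" is at most the sum of the two values
(a best prover for the disjunction is no better than the two best provers together). [folklore] -/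
theorem opt_union_le (G : PCGame R M) (A B : R → List M → Prop) (n : ℕ) (h : List M) :
    (G.withAccept fun r h => A r h ∨ B r h).opt n h ≤
      (G.withAccept A).opt n h + (G.withAccept B).opt n h := by
  induction n generalizing h with
  | zero =>
    simp only [opt]
    refine (card_le_card fun r hr => ?_).trans (card_union_le _ _)
    simp only [mem_filter, mem_univ, true_and, mem_union] at hr ⊢
    rcases hr.2 with hA | hB
    · exact Or.inl ⟨hr.1, hA⟩
    · exact Or.inr ⟨hr.1, hB⟩
  | succ n ih =>
    by_cases he : Even h.length
    · rw [opt_succ_of_even _ he, opt_succ_of_even _ he, opt_succ_of_even _ he, ← sum_add_distrib]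
      exact sum_le_sum fun a _ => ih (h ++ [a])
    · rw [opt_succ_of_not_even _ he, opt_succ_of_not_even _ he, opt_succ_of_not_even _ he]
      exact Finset.sup_le fun b _ => (ih (h ++ [b])).trans (add_le_add
        (le_sup (f := fun b : M => (G.withAccept A).opt n (h ++ [b])) (mem_univ b))
        (le_sup (f := fun b : M => (G.withAccept B).opt n (h ++ [b])) (mem_univ b)))

open scoped Classical in
/-- **A verdict the prover cannot influence**: if acceptance is an event `E` of the coins alone,
the value from `h` is at most (in fact exactly) the number of consistent coins in `E`. [folklore] -/
theorem opt_indep_le (G : PCGame R M) (E : R → Prop) (n : ℕ) (h : List M) :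
    (G.withAccept fun r _ => E r).opt n h ≤ (univ.filter fun r => G.Consistent r h ∧ E r).card := by
  induction n generalizing h with
  | zero => exact le_of_eq rfl
  | succ n ih =>
    by_cases he : Even h.length
    · rw [opt_succ_of_even _ he,
        card_eq_sum_card_fiberwise (f := fun r => G.next r h) (t := univ) fun _ _ => mem_univ _]
      refine sum_le_sum fun a _ => (ih (h ++ [a])).trans (card_le_card fun r hr => ?_)
      simp only [mem_filter, mem_univ, true_and] at hr ⊢
      obtain ⟨hc, hra⟩ := (G.consistent_append_iff_of_even r he a).1 hr.1
      exact ⟨⟨hc, hr.2⟩, hra.symm⟩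
    · rw [opt_succ_of_not_even _ he]
      refine Finset.sup_le fun b _ => (ih (h ++ [b])).trans (card_le_card fun r hr => ?_)
      simp only [mem_filter, mem_univ, true_and] at hr ⊢
      exact ⟨(G.consistent_append_iff_of_not_even r he b).1 hr.1, hr.2⟩

open scoped Classical in
/-- In particular for the whole game: a coins-only verdict `E` has value at most `#E`.
[folklore] -/
theorem opt_indep_nil_le (G : PCGame R M) (E : R → Prop) (k : ℕ) :
    (G.withAccept fun r _ => E r).opt k [] ≤ (univ.filter fun r => E r).card := by
  simpa [consistent_nil] using G.opt_indep_le E k []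

open scoped Classical in
/-- **Conditioning on good coins**: for any event `E` of the coins ("bad coins"), the value of a
game is at most the value of the game that also insists on good coins, plus `#E`. This is the step
"with probability `≥ 1 - δ` over the verifier's choices … ; conditioned on that, no prover …" of
every protocol analysis. [folklore] -/
theorem opt_le_opt_good_add_card (G : PCGame R M) (E : R → Prop) (k : ℕ) :
    G.opt k [] ≤ (G.withAccept fun r h => G.accept r h ∧ ¬ E r).opt k [] +
      (univ.filter fun r => E r).card := by
  have hsplit : (G.withAccept G.accept).opt k [] ≤
      (G.withAccept fun r h => (G.accept r h ∧ ¬ E r) ∨ E r).opt k [] :=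
    G.opt_mono (fun r h hacc => by by_cases hE : E r <;> simp [hacc, hE]) k []
  rw [withAccept_accept] at hsplit
  refine hsplit.trans ((G.opt_union_le _ _ k []).trans (add_le_add le_rfl ?_))
  exact G.opt_indep_nil_le E k

end PCGame

end Literature.Computability.Complexity
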